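import Literature.Geometry.DiscreteGeometry.ThreePointEnergyBound
import HarnessLib

/-!
# The three-point energy bound with its deficit: an exact identity (equality cases of Cohn–Woo's theorem)

Framing: lottery ticket; floor = certified bounds/negative ranges. Venture `PackingBounds`, cell
`pub-packcert`, energy family E3PT (pub-packcert-energy gen 11).

`CohnWoo.energy_ge_of_threePoint` (Cohn–Woo 2012, Thm 3.2) drops three nonnegative quantities. Here we
keep them: for `N = |C| ≥ 3` unit vectors, ANY `f, A, F, c` (with `F` symmetric),
`Σ_{x≠y} f(x·y) - N((N-1)c - F(1,1,1) - A(1))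
   = (1/(3(N-2))) · Σ_{(x,y,z) distinct} slack(x·y, x·z, y·z) + Σ_{x,y,z} F + Σ_{x,y} A`,
where `slack(u,v,t) = f(u)+f(v)+f(t) - 3c - 3(N-2)F(u,v,t) - 3(F(u,u,1)+F(v,v,1)+F(t,t,1)) - (A(u)+A(v)+A(t))`
(`ThreePointDeficit.energy_sub_bound_eq`). Consequently a configuration attaining a sharp three-point
bound has `Σ_{x,y} A(x·y) = 0`, `Σ_{x,y,z} F = 0` and zero slack at every distinct triple
(`pairSum_eq_zero_of_sharp` etc.) — the complementary-slackness facts from which rigidity / uniqueness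
of minimisers is read off (e.g. for `A = a₁·t`, `a₁ > 0`: `Σ_{x∈C} x = 0`).
-/

noncomputable section

open Finset
open scoped RealInnerProductSpace

namespace Summit.Ventures.PackingBounds.Energy.ThreePointDeficit

open Literature.Geometry.DiscreteGeometry

variable {n : ℕ}

/-- **Cohn–Woo's three-point bound as an exact identity with its deficit.** For `N = |C| ≥ 3` unit
vectors and any `f, A, c` and symmetric `F`:
`Σ_{x≠y} f - N((N-1)c - F(1,1,1) - A(1)) = (1/(3(N-2)))·Σ_{distinct triples} slack + Σ_{C³} F + Σ_{C²} A`. -/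
theorem energy_sub_bound_eq [DecidableEq (EuclideanSpace ℝ (Fin n))]
    (C : Finset (EuclideanSpace ℝ (Fin n))) (hC : ∀ x ∈ C, ‖x‖ = 1) (hN : 3 ≤ C.card)
    (f : ℝ → ℝ) (A : ℝ → ℝ) (F : ℝ → ℝ → ℝ → ℝ) (c : ℝ)
    (hF12 : ∀ u v t, F u v t = F v u t) (hF23 : ∀ u v t, F u v t = F u t v) :
    (∑ x ∈ C, ∑ y ∈ C.erase x, f (inner ℝ x y))
      - (C.card : ℝ) * (((C.card : ℝ) - 1) * c - F 1 1 1 - A 1)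
      = (1 / (3 * ((C.card : ℝ) - 2))) *
          (∑ x ∈ C, ∑ y ∈ C.erase x, ∑ z ∈ (C.erase x).erase y,
            ((f (inner ℝ x y) + f (inner ℝ x z) + f (inner ℝ y z))
              - (3 * c + 3 * (((C.card : ℝ) - 2) * F (inner ℝ x y) (inner ℝ x z) (inner ℝ y z))
                + 3 * (F (inner ℝ x y) (inner ℝ x y) 1 + F (inner ℝ x z) (inner ℝ x z) 1
                  + F (inner ℝ y z) (inner ℝ y z) 1)
                + (A (inner ℝ x y) + A (inner ℝ x z) + A (inner ℝ y z)))))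
        + BachocVallentin.tripleSum C F + BachocVallentin.pairSum C A := by
  set M : ℝ := (C.card : ℝ) with hM
  have hM3 : (3 : ℝ) ≤ M := by rw [hM]; exact_mod_cast hN
  have hself : ∀ x ∈ C, inner ℝ x x = (1 : ℝ) := fun x hx => by
    rw [real_inner_self_eq_norm_sq, hC x hx]; norm_num
  have hcard1 : ∀ x ∈ C, ((C.erase x).card : ℝ) = M - 1 := by
    intro x hx
    rw [Finset.card_erase_of_mem hx, Nat.cast_sub (Finset.card_pos.2 ⟨x, hx⟩), hM]; simp
  have hcard2 : ∀ x ∈ C, ∀ y ∈ C.erase x, (((C.erase x).erase y).card : ℝ) = M - 2 := by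
    intro x hx y hy
    have h2 : 2 ≤ C.card := by
      have : (C.erase x).card = C.card - 1 := Finset.card_erase_of_mem hx
      have hp : 0 < (C.erase x).card := Finset.card_pos.2 ⟨y, hy⟩
      omega
    rw [Finset.card_erase_of_mem hy, Finset.card_erase_of_mem hx, Nat.sub_sub,
      Nat.cast_sub h2, hM]
    norm_num
  -- pair sum split
  have hpair : BachocVallentin.pairSum C A = M * A 1 + ∑ x ∈ C, ∑ y ∈ C.erase x, A (inner ℝ x y) := by
    unfold BachocVallentin.pairSum
    rw [show M * A 1 = ∑ x ∈ C, A 1 by rw [Finset.sum_const, nsmul_eq_mul, hM],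
      ← Finset.sum_add_distrib]
    refine Finset.sum_congr rfl fun x hx => ?_
    rw [← Finset.add_sum_erase C _ hx, hself x hx]
  -- triple sum split
  have htriple : BachocVallentin.tripleSum C F = M * F 1 1 1
      + 3 * ∑ x ∈ C, ∑ y ∈ C.erase x, F (inner ℝ x y) (inner ℝ x y) 1
      + ∑ x ∈ C, ∑ y ∈ C.erase x, ∑ z ∈ (C.erase x).erase y,
          F (inner ℝ x y) (inner ℝ x z) (inner ℝ y z) := by
    unfold BachocVallentin.tripleSum
    have hx_split : ∀ x ∈ C,
        (∑ y ∈ C, ∑ z ∈ C, F (inner ℝ x y) (inner ℝ x z) (inner ℝ y z)) =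
          F 1 1 1 + 3 * ∑ y ∈ C.erase x, F (inner ℝ x y) (inner ℝ x y) 1 +
            ∑ y ∈ C.erase x, ∑ z ∈ (C.erase x).erase y,
              F (inner ℝ x y) (inner ℝ x z) (inner ℝ y z) := by
      intro x hx
      rw [← Finset.add_sum_erase C _ hx]
      have hyx : (∑ z ∈ C, F (inner ℝ x x) (inner ℝ x z) (inner ℝ x z)) =
          F 1 1 1 + ∑ z ∈ C.erase x, F (inner ℝ x z) (inner ℝ x z) 1 := by
        rw [← Finset.add_sum_erase C _ hx, hself x hx]
        congr 1
        refine Finset.sum_congr rfl fun z _ => ?_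
        rw [hF12, hF23]
      have hyne : ∀ y ∈ C.erase x,
          (∑ z ∈ C, F (inner ℝ x y) (inner ℝ x z) (inner ℝ y z)) =
            2 * F (inner ℝ x y) (inner ℝ x y) 1 +
              ∑ z ∈ (C.erase x).erase y, F (inner ℝ x y) (inner ℝ x z) (inner ℝ y z) := by
        intro y hy
        have hyC : y ∈ C := Finset.mem_of_mem_erase hy
        rw [← Finset.add_sum_erase C _ hx, ← Finset.add_sum_erase (C.erase x) _ hy, hself x hx,
          hself y hyC, real_inner_comm x y]
        have e1 : F (inner ℝ x y) 1 (inner ℝ x y) = F (inner ℝ x y) (inner ℝ x y) 1 := by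
          rw [hF23]
        rw [e1]; ring
      rw [hyx, Finset.sum_congr rfl hyne, Finset.sum_add_distrib, ← Finset.mul_sum]
      ring
    rw [Finset.sum_congr rfl hx_split, Finset.sum_add_distrib, Finset.sum_add_distrib,
      Finset.sum_const, nsmul_eq_mul, ← hM, ← Finset.mul_sum]
  -- the summed pieces
  have hsplit : (∑ x ∈ C, ∑ y ∈ C.erase x, ∑ z ∈ (C.erase x).erase y,
      ((f (inner ℝ x y) + f (inner ℝ x z) + f (inner ℝ y z))
        - (3 * c + 3 * ((M - 2) * F (inner ℝ x y) (inner ℝ x z) (inner ℝ y z))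
          + 3 * (F (inner ℝ x y) (inner ℝ x y) 1 + F (inner ℝ x z) (inner ℝ x z) 1
            + F (inner ℝ y z) (inner ℝ y z) 1)
          + (A (inner ℝ x y) + A (inner ℝ x z) + A (inner ℝ y z)))))
      = (∑ x ∈ C, ∑ y ∈ C.erase x, ∑ z ∈ (C.erase x).erase y,
            (f (inner ℝ x y) + f (inner ℝ x z) + f (inner ℝ y z)))
        - ((∑ x ∈ C, ∑ y ∈ C.erase x, ∑ z ∈ (C.erase x).erase y, 3 * c)
          + (∑ x ∈ C, ∑ y ∈ C.erase x, ∑ z ∈ (C.erase x).erase y,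
              3 * ((M - 2) * F (inner ℝ x y) (inner ℝ x z) (inner ℝ y z)))
          + (∑ x ∈ C, ∑ y ∈ C.erase x, ∑ z ∈ (C.erase x).erase y,
              3 * (F (inner ℝ x y) (inner ℝ x y) 1 + F (inner ℝ x z) (inner ℝ x z) 1
                + F (inner ℝ y z) (inner ℝ y z) 1))
          + (∑ x ∈ C, ∑ y ∈ C.erase x, ∑ z ∈ (C.erase x).erase y,
              (A (inner ℝ x y) + A (inner ℝ x z) + A (inner ℝ y z)))) := by
    simp only [Finset.sum_add_distrib, Finset.sum_sub_distrib]
  have eC : (∑ x ∈ C, ∑ y ∈ C.erase x, ∑ z ∈ (C.erase x).erase y, 3 * c)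
      = M * (M - 1) * (M - 2) * (3 * c) := by
    have hin : ∀ x ∈ C, (∑ y ∈ C.erase x, ∑ z ∈ (C.erase x).erase y, 3 * c)
        = (M - 1) * ((M - 2) * (3 * c)) := by
      intro x hx
      have hin2 : ∀ y ∈ C.erase x, (∑ z ∈ (C.erase x).erase y, 3 * c) = (M - 2) * (3 * c) := by
        intro y hy
        rw [Finset.sum_const, nsmul_eq_mul, hcard2 x hx y hy]
      rw [Finset.sum_congr rfl hin2, Finset.sum_const, nsmul_eq_mul, hcard1 x hx]
    rw [Finset.sum_congr rfl hin, Finset.sum_const, nsmul_eq_mul, ← hM]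
    ring
  have eF : (∑ x ∈ C, ∑ y ∈ C.erase x, ∑ z ∈ (C.erase x).erase y,
        3 * ((M - 2) * F (inner ℝ x y) (inner ℝ x z) (inner ℝ y z)))
      = 3 * (M - 2) * ∑ x ∈ C, ∑ y ∈ C.erase x, ∑ z ∈ (C.erase x).erase y,
          F (inner ℝ x y) (inner ℝ x z) (inner ℝ y z) := by
    simp only [Finset.mul_sum]
    refine Finset.sum_congr rfl fun x _ => Finset.sum_congr rfl fun y _ =>
      Finset.sum_congr rfl fun z _ => ?_
    ring
  have eFF : (∑ x ∈ C, ∑ y ∈ C.erase x, ∑ z ∈ (C.erase x).erase y,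
        3 * (F (inner ℝ x y) (inner ℝ x y) 1 + F (inner ℝ x z) (inner ℝ x z) 1
          + F (inner ℝ y z) (inner ℝ y z) 1))
      = 3 * (3 * (M - 2) * ∑ x ∈ C, ∑ y ∈ C.erase x, F (inner ℝ x y) (inner ℝ x y) 1) := by
    rw [← CohnWoo.sum3_distinct_uni C (fun w => F w w 1)]
    simp only [Finset.mul_sum]
  have eA : (∑ x ∈ C, ∑ y ∈ C.erase x, ∑ z ∈ (C.erase x).erase y,
        (A (inner ℝ x y) + A (inner ℝ x z) + A (inner ℝ y z)))
      = 3 * (M - 2) * ∑ x ∈ C, ∑ y ∈ C.erase x, A (inner ℝ x y) :=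
    CohnWoo.sum3_distinct_uni C A
  have eP : (∑ x ∈ C, ∑ y ∈ C.erase x, ∑ z ∈ (C.erase x).erase y,
        (f (inner ℝ x y) + f (inner ℝ x z) + f (inner ℝ y z)))
      = 3 * (M - 2) * ∑ x ∈ C, ∑ y ∈ C.erase x, f (inner ℝ x y) :=
    CohnWoo.sum3_distinct_uni C f
  have hM2 : (M - 2) ≠ 0 := by
    have : 0 < M - 2 := by linarith
    exact this.ne'
  rw [hsplit, eC, eF, eFF, eA, eP, htriple, hpair]
  field_simp
  ring

/-- **Complementary slackness, two-point part.** If the hypotheses of Cohn–Woo's theorem hold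
(pointwise inequality on the domain, `Σ A ≥ 0`, `Σ F ≥ 0`) and the configuration ATTAINS the bound, then
`Σ_{x,y ∈ C} A(x·y) = 0`. -/
theorem pairSum_eq_zero_of_sharp [DecidableEq (EuclideanSpace ℝ (Fin n))]
    (C : Finset (EuclideanSpace ℝ (Fin n))) (hC : ∀ x ∈ C, ‖x‖ = 1) (hN : 3 ≤ C.card)
    (f : ℝ → ℝ) (A : ℝ → ℝ) (F : ℝ → ℝ → ℝ → ℝ) (c : ℝ)
    (hA : 0 ≤ BachocVallentin.pairSum C A) (hF : 0 ≤ BachocVallentin.tripleSum C F)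
    (hF12 : ∀ u v t, F u v t = F v u t) (hF23 : ∀ u v t, F u v t = F u t v)
    (h : ∀ u v t : ℝ, -1 ≤ u → u < 1 → -1 ≤ v → v < 1 → -1 ≤ t → t < 1 →
      0 ≤ 1 + 2 * u * v * t - u ^ 2 - v ^ 2 - t ^ 2 →
      c + ((C.card : ℝ) - 2) * F u v t + F u u 1 + F v v 1 + F t t 1 + (A u + A v + A t) / 3
        ≤ (f u + f v + f t) / 3)
    (hsharp : ∑ x ∈ C, ∑ y ∈ C.erase x, f (inner ℝ x y)
        = (C.card : ℝ) * (((C.card : ℝ) - 1) * c - F 1 1 1 - A 1)) :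
    BachocVallentin.pairSum C A = 0 ∧ BachocVallentin.tripleSum C F = 0 := by
  have hid := energy_sub_bound_eq C hC hN f A F c hF12 hF23
  rw [hsharp, sub_self] at hid
  have hM3 : (3 : ℝ) ≤ (C.card : ℝ) := by exact_mod_cast hN
  have hrange : ∀ x ∈ C, ∀ y ∈ C, x ≠ y → -1 ≤ inner ℝ x y ∧ inner ℝ x y < 1 := by
    intro x hx y hy hxy
    refine ⟨neg_one_le_real_inner_of_norm_eq_one (hC x hx) (hC y hy),
      lt_of_le_of_ne (real_inner_le_one_of_norm_eq_one (hC x hx) (hC y hy)) ?_⟩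
    intro h1
    exact hxy ((inner_eq_one_iff_of_norm_eq_one (𝕜 := ℝ) (hC x hx) (hC y hy)).1 h1)
  have hS : 0 ≤ ∑ x ∈ C, ∑ y ∈ C.erase x, ∑ z ∈ (C.erase x).erase y,
      ((f (inner ℝ x y) + f (inner ℝ x z) + f (inner ℝ y z))
        - (3 * c + 3 * (((C.card : ℝ) - 2) * F (inner ℝ x y) (inner ℝ x z) (inner ℝ y z))
          + 3 * (F (inner ℝ x y) (inner ℝ x y) 1 + F (inner ℝ x z) (inner ℝ x z) 1
            + F (inner ℝ y z) (inner ℝ y z) 1)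
          + (A (inner ℝ x y) + A (inner ℝ x z) + A (inner ℝ y z)))) := by
    refine Finset.sum_nonneg fun x hx => Finset.sum_nonneg fun y hy => Finset.sum_nonneg fun z hz => ?_
    have hyC : y ∈ C := Finset.mem_of_mem_erase hy
    have hxy : x ≠ y := fun h => (Finset.ne_of_mem_erase hy) h.symm
    have hz1 : z ∈ C.erase x := Finset.mem_of_mem_erase hz
    have hzC : z ∈ C := Finset.mem_of_mem_erase hz1
    have hzy : z ≠ y := Finset.ne_of_mem_erase hz
    have hzx : z ≠ x := Finset.ne_of_mem_erase hz1
    obtain ⟨lo1, hi1⟩ := hrange x hx y hyC hxy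
    obtain ⟨lo2, hi2⟩ := hrange x hx z hzC hzx.symm
    obtain ⟨lo3, hi3⟩ := hrange y hyC z hzC hzy.symm
    have h0 := h _ _ _ lo1 hi1 lo2 hi2 lo3 hi3
      (BachocVallentin.gram3_nonneg x y z (hC x hx) (hC y hyC) (hC z hzC))
    linarith
  have hpos : 0 < 1 / (3 * ((C.card : ℝ) - 2)) := by
    apply div_pos one_pos; linarith
  have hT : 0 ≤ 1 / (3 * ((C.card : ℝ) - 2)) * ∑ x ∈ C, ∑ y ∈ C.erase x, ∑ z ∈ (C.erase x).erase y,
      ((f (inner ℝ x y) + f (inner ℝ x z) + f (inner ℝ y z))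
        - (3 * c + 3 * (((C.card : ℝ) - 2) * F (inner ℝ x y) (inner ℝ x z) (inner ℝ y z))
          + 3 * (F (inner ℝ x y) (inner ℝ x y) 1 + F (inner ℝ x z) (inner ℝ x z) 1
            + F (inner ℝ y z) (inner ℝ y z) 1)
          + (A (inner ℝ x y) + A (inner ℝ x z) + A (inner ℝ y z)))) := mul_nonneg hpos.le hS
  constructor <;> linarith

/-- **Balanced minimisers.** With the linear two-point part `A(t) = a₁ t`, `a₁ > 0`: a configuration
attaining the bound has `Σ_{x ∈ C} x = 0` (since `Σ_{x,y} x·y = ‖Σ x‖²`). -/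
theorem sum_eq_zero_of_sharp [DecidableEq (EuclideanSpace ℝ (Fin n))]
    (C : Finset (EuclideanSpace ℝ (Fin n))) (a₁ : ℝ) (ha : 0 < a₁)
    (hA0 : BachocVallentin.pairSum C (fun t => a₁ * t) = 0) : ∑ x ∈ C, x = 0 := by
  have hps : BachocVallentin.pairSum C (fun t => a₁ * t) = a₁ * ‖∑ x ∈ C, x‖ ^ 2 := by
    unfold BachocVallentin.pairSum
    rw [← real_inner_self_eq_norm_sq, sum_inner, Finset.mul_sum]
    refine Finset.sum_congr rfl fun x _ => ?_
    rw [inner_sum, Finset.mul_sum]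
  rw [hps] at hA0
  have h2 : ‖∑ x ∈ C, x‖ ^ 2 = 0 := by
    rcases mul_eq_zero.1 hA0 with h | h
    · exact absurd h ha.ne'
    · exact h
  have h3 : ‖∑ x ∈ C, x‖ = 0 := pow_eq_zero_iff (two_ne_zero) |>.1 h2
  exact norm_eq_zero.1 h3

end Summit.Ventures.PackingBounds.Energy.ThreePointDeficit
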